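import Literature.Computability.QuantumComplexity.PostBQPMachine
import Literature.Computability.QuantumComplexity.CountingSimulation
import Literature.Computability.Complexity.CountingHierarchyProofs
import HarnessLib

/-!
# `PostBQP ⊆ PP` (Aaronson 2005, Prop. 2): the counting assembly

Third file of the proof of `PostBQP ⊆ PP` for the tree's `PostBQP` (`Cryptography/Postselection.lean`:
polynomial-time uniform oracle-free Clifford+`T` families, output wire `0`, post-selection wire `1`,
`Pr[post] > 0`, conditional acceptance `≥ 2/3` / `≤ 1/3`) and `PP = pMajority P` (Gill's strict
majority), after

* `PostBQPPathSums.lean` (quantum half): the integer count `X = extX evWt gates w₀ k` of the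
  event-weighted, phase-coin-prolonged path pairs has the sign of `2·Pr[11] − Pr[·1]` under the
  `PostBQP` promise as soon as `k ≥ h + 2` (`extX_pos`, `extX_neg`);
* `PostBQPMachine.lean` (machine half): the polynomial-time predicate `postFn F` answering, on
  `⟨x, b b' t t' e u⟩`, `wtAnswer (wtA evWt gates w₀ b b' t t') e` (`postFn_boolPair`).

Here: with `μ` gates, `k = |descFn x|` phase coins per path and `P` padding coins, exactly
`2^P (4^μ 4^k + X)` of the `2^{2μ + 2k + 1 + P}` guess strings are accepted (`cnt_postLang`), so the
strict majority holds iff `X > 0` iff `x ∈ L` (**`PostBQP_subset_PP`**); the coin polynomial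
`4s + 1` comes from the output-length bound `s` of the uniformity machine, and `k = |descFn x| ≥ 2μ + 4`
supplies `k ≥ h + 2`. The bridges `postselectProbOn_eq_prS`, `jointAcceptProbOn_eq_prJ` identify the
family's post-selection data with the Born sums of `PostBQPPathSums.lean`, and `cA_accSign`,
`cB_accSign` record that the weighted pair sums there specialise to the ADH sums `adhA`, `adhB` of
`CliffordTPathSums.lean`. Finally `PostBQP_eq_PP_of` reduces both copies of the named fact
`PostBQP = PP` (Q4 `Cryptography.PostBQP_eq_PP` and quantum-advantage.S16
`QuantumComplexity.PostBQP_eq_PP`) to the remaining inclusion `PP ⊆ PostBQP` (Aaronson's Thm. 4,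
the post-selected counting algorithm — not in this file).

## References

* S. Aaronson, *Quantum computing, postselection, and probabilistic polynomial-time*, Proc. R.
  Soc. A 461 (2005) 3473–3482, doi:10.1098/rspa.2005.1546, arXiv:quant-ph/0412187: §3 Def. 1,
  Prop. 2 (`PostBQP ⊆ PP`) and its proof; Thm. 4 (`PostBQP = PP`).
* L. M. Adleman, J. DeMarrais, M.-D. A. Huang, *Quantum computability*, SIAM J. Comput. 26 (1997)
  1524–1540, Thm. 6.4 and Lemma 6.10 (the counting of path pairs).
* J. Gill, *Computational complexity of probabilistic Turing machines*, SIAM J. Comput. 6 (1977),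
  Def. 5.1 (`PP` by strict majority).
-/

noncomputable section

namespace Literature.Computability.QuantumComplexity

open _root_.Computability Polynomial Complexity Complexity.Classes Cryptography ADH PostPP

variable (F : QCircuitFamily cliffordT)

/-! ### The witness language -/

/-- **The post-selected ADH language** `L' = {⟨x, y⟩ | postFn F ⟨x, y⟩ = 1}`: the polynomial-time
predicate of the `P·P` presentation of a `PostBQP` language. [cite: Aaronson2005, §3 Prop. 2 (proof)] -/
def postLang : Language Bool := {z | postFn F z = [true]}

/-- **`L' ∈ P`** for a uniform family. [cite: Aaronson2005, §3 Prop. 2 (proof: "computable in classical polynomial time")] -/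
theorem postLang_mem_P (hU : F.IsUniform) : postLang F ∈ P :=
  mem_P_of_mem_FP (postFn_mem_FP F hU) _ fun z =>
    ⟨fun h => h, fun h => by
      obtain ⟨b, hb⟩ := oneBit_postFn F z
      cases b
      · exact hb
      · exact absurd hb h⟩

/-! ### Bridges: family probabilities as Born sums of the `ω`-semantics -/

/-- **`Pr[post = 1]` of an oracle-free family is `prS ω`** of its gate list on the padded input.
[cite: Aaronson2005, §3 Def. 1 (i)] -/
theorem postselectProbOn_eq_prS (hF : F.IsOracleFree) (A : Language Bool) (x : List Bool) :
    F.postselectProbOn A x = prS omega (F.circ x.length).gates (w₀ F x) := by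
  classical
  unfold QCircuitFamily.postselectProbOn QCircuit.postselectProb QCircuit.probEvent prS QCircuit.runOn
  rw [Finset.sum_filter, ← prodZeta_omega A (hF x.length)]
  refine Finset.sum_congr rfl fun z _ => ?_
  congr 1

/-- **`Pr[out = 1 ∧ post = 1]` of an oracle-free family is `prJ ω`.** [cite: Aaronson2005, §3 Def. 1 (ii)] -/
theorem jointAcceptProbOn_eq_prJ (hF : F.IsOracleFree) (A : Language Bool) (x : List Bool) :
    F.jointAcceptProbOn A x = prJ omega (F.circ x.length).gates (w₀ F x) := by
  classical
  unfold QCircuitFamily.jointAcceptProbOn QCircuit.jointAcceptProb QCircuit.probEvent prJ QCircuit.runOn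
  rw [Finset.sum_filter, ← prodZeta_omega A (hF x.length)]
  refine Finset.sum_congr rfl fun z _ => ?_
  congr 1

/-- The conditional acceptance probability as `prJ ω / prS ω`. [cite: Aaronson2005, §3 Def. 1 (ii)–(iii)] -/
theorem condAcceptProbOn_eq (hF : F.IsOracleFree) (x : List Bool) :
    F.condAcceptProbOn 0 x =
      prJ omega (F.circ x.length).gates (w₀ F x) / prS omega (F.circ x.length).gates (w₀ F x) := by
  rw [← postselectProbOn_eq_prS F hF 0 x, ← jointAcceptProbOn_eq_prJ F hF 0 x]
  rfl

/-- The weighted integer pair sum of `PostBQPPathSums` specialises to the ADH sum: `cA accSign = 𝔄`.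
[cite: AdlemanDeMarraisHuang1997, §6 Lemma 6.10 (proof, p. 1539)] -/
theorem cA_accSign {M : ℕ} (gs : List (QGate cliffordT M)) (w : QReg M) : cA accSign gs w = adhA gs w := rfl

/-- Likewise `cB accSign = 𝔅`. [cite: AdlemanDeMarraisHuang1997, §6 Lemma 6.10 (proof, p. 1539)] -/
theorem cB_accSign {M : ℕ} (gs : List (QGate cliffordT M)) (w : QReg M) : cB accSign gs w = adhB gs w := rfl

/-! ### Counting the accepted guesses -/

/-- Over the two values of the extra coin, the number of "yes" answers is `1 + w` for a weight
`w ∈ {0, ±1}`. [cite: Aaronson2005, §3 Prop. 2 (proof: the two sides of the ledger)] -/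
theorem wtAnswer_count (w : ℤ) (hw : |w| ≤ 1) (P : ℕ) :
    (((if wtAnswer w false = true then 2 ^ P else 0) + (if wtAnswer w true = true then 2 ^ P else 0) : ℕ) : ℤ) =
      2 ^ P * (1 + w) := by
  obtain ⟨h1, h2⟩ := abs_le.1 hw
  interval_cases w
  · simp [wtAnswer]
  · simp [wtAnswer]
  · simp [wtAnswer]; ring

/-- **The number of accepted guesses.** With `μ` gates, `k = |descFn x|` phase coins per path and
`P` padding coins, exactly `2^P (4^μ · 4^k + X)` of the guess strings
`y = b b' t t' e u ∈ {0,1}^{2μ + 2k + 1 + P}` put `⟨x, y⟩` into the witness language, `X = extX`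
being the signed count of `PostBQPPathSums` (`4^μ 4^k` written as a product of powers of `2`).
[cite: Aaronson2005, §3 Prop. 2 (proof)] -/
theorem cnt_postLang (hF : F.IsOracleFree) (x : List Bool) (P : ℕ) :
    (cnt ((F.circ x.length).gates.length + ((F.circ x.length).gates.length +
        ((F.descFn x).length + ((F.descFn x).length + (P + 1)))))
        {y | boolPair x y ∈ postLang F} : ℤ) =
      2 ^ P * (2 ^ (F.circ x.length).gates.length * 2 ^ (F.circ x.length).gates.length *
          2 ^ (F.descFn x).length * 2 ^ (F.descFn x).length +
        extX evWt (F.circ x.length).gates (w₀ F x) (F.descFn x).length) := by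
  set gs := (F.circ x.length).gates with hgs
  set μ := gs.length with hμ
  set k := (F.descFn x).length with hk
  have step : (cnt (μ + (μ + (k + (k + (P + 1))))) {y | boolPair x y ∈ postLang F} : ℤ) =
      ∑ b : List.Vector Bool μ, ∑ b' : List.Vector Bool μ, ∑ t : List.Vector Bool k, ∑ t' : List.Vector Bool k,
        (2 : ℤ) ^ P * (1 + wtA evWt gs (w₀ F x) b.toList b'.toList t.toList t'.toList) := by
    rw [cnt_add_eq_sum]
    push_cast
    refine Finset.sum_congr rfl fun b _ => ?_
    rw [cnt_add_eq_sum]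
    push_cast
    refine Finset.sum_congr rfl fun b' _ => ?_
    rw [cnt_add_eq_sum]
    push_cast
    refine Finset.sum_congr rfl fun t _ => ?_
    rw [cnt_add_eq_sum]
    push_cast
    refine Finset.sum_congr rfl fun t' _ => ?_
    have hval : ∀ (e : Bool) (u : List Bool),
        (e :: u ∈ {v : List Bool | t'.toList ++ v ∈ {v : List Bool | t.toList ++ v ∈ {v : List Bool | b'.toList ++ v ∈
          {v : List Bool | b.toList ++ v ∈ {y : List Bool | boolPair x y ∈ postLang F}}}}}) ↔
          wtAnswer (wtA evWt gs (w₀ F x) b.toList b'.toList t.toList t'.toList) e = true := by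
      intro e u
      show postFn F (boolPair x (b.toList ++ (b'.toList ++ (t.toList ++ (t'.toList ++ e :: u))))) = [true] ↔ _
      rw [postFn_boolPair F hF x b.toList b'.toList t.toList t'.toList u e (by simp [hμ, hgs]) (by simp [hμ, hgs])
        (by simp [hk]) (by simp [hk]), ← hgs]
      simp
    rw [cnt_succ,
      show {u : List Bool | false :: u ∈ {v : List Bool | t'.toList ++ v ∈ {v : List Bool | t.toList ++ v ∈
        {v : List Bool | b'.toList ++ v ∈ {v : List Bool | b.toList ++ v ∈
        {y : List Bool | boolPair x y ∈ postLang F}}}}}} =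
        {_u | wtAnswer (wtA evWt gs (w₀ F x) b.toList b'.toList t.toList t'.toList) false = true}
        from Set.ext (hval false),
      show {u : List Bool | true :: u ∈ {v : List Bool | t'.toList ++ v ∈ {v : List Bool | t.toList ++ v ∈
        {v : List Bool | b'.toList ++ v ∈ {v : List Bool | b.toList ++ v ∈
        {y : List Bool | boolPair x y ∈ postLang F}}}}}} =
        {_u | wtAnswer (wtA evWt gs (w₀ F x) b.toList b'.toList t.toList t'.toList) true = true}
        from Set.ext (hval true),
      cnt_const, cnt_const]
    exact wtAnswer_count _ (abs_wtA_le abs_evWt_le_one gs (w₀ F x) _ _ _ _) P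
  have hW : ∑ b : List.Vector Bool μ, ∑ b' : List.Vector Bool μ, ∑ t : List.Vector Bool k, ∑ t' : List.Vector Bool k,
      wtA evWt gs (w₀ F x) b.toList b'.toList t.toList t'.toList = extX evWt gs (w₀ F x) k := by
    unfold extX
    rw [sum_vector_eq_sum_fn μ (fun l => ∑ b' : List.Vector Bool μ, ∑ t : List.Vector Bool k,
      ∑ t' : List.Vector Bool k, wtA evWt gs (w₀ F x) l b'.toList t.toList t'.toList)]
    refine Finset.sum_congr rfl fun b _ => ?_
    rw [sum_vector_eq_sum_fn μ (fun l' => ∑ t : List.Vector Bool k, ∑ t' : List.Vector Bool k,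
      wtA evWt gs (w₀ F x) (List.ofFn b) l' t.toList t'.toList)]
    refine Finset.sum_congr rfl fun b' _ => ?_
    rw [sum_vector_eq_sum_fn k (fun l => ∑ t' : List.Vector Bool k,
      wtA evWt gs (w₀ F x) (List.ofFn b) (List.ofFn b') l t'.toList)]
    refine Finset.sum_congr rfl fun t _ => ?_
    exact sum_vector_eq_sum_fn k (fun l' => wtA evWt gs (w₀ F x) (List.ofFn b) (List.ofFn b') (List.ofFn t) l')
  rw [step, ← hW]
  simp only [mul_add, mul_one, Finset.sum_add_distrib, Finset.sum_const, Finset.card_univ, card_vector,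
    Fintype.card_bool, ← Finset.mul_sum]
  ring

/-- **The majority balance**: `2 · #accepted − 2^{#coins} = 2^{P+1} · X`.
[cite: Aaronson2005, §3 Prop. 2 (proof)] -/
theorem two_mul_cnt_postLang_sub (hF : F.IsOracleFree) (x : List Bool) (P : ℕ) :
    2 * (cnt ((F.circ x.length).gates.length + ((F.circ x.length).gates.length +
        ((F.descFn x).length + ((F.descFn x).length + (P + 1)))))
        {y | boolPair x y ∈ postLang F} : ℤ) -
      ((2 ^ ((F.circ x.length).gates.length + ((F.circ x.length).gates.length +
        ((F.descFn x).length + ((F.descFn x).length + (P + 1))))) : ℕ) : ℤ) =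
      2 ^ (P + 1) * extX evWt (F.circ x.length).gates (w₀ F x) (F.descFn x).length := by
  rw [cnt_postLang F hF x P]
  push_cast
  ring

/-! ### The coin polynomial and the number of phase coins -/

/-- A polynomial bounding `2μ(n) + 2|d(n)| + 1` (four times the output-length bound of the
uniformity machine plus one; `μ ≤ |d|`). [cite: AroraBarak2009, §6.2 (P-uniform families), §1.3] -/
theorem exists_postCoinPoly (hU : F.IsUniform) :
    ∃ p : Polynomial ℕ, ∀ x : List Bool,
      2 * (F.circ x.length).gates.length + 2 * (F.descFn x).length + 1 ≤ p.eval x.length := by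
  obtain ⟨s, hs⟩ := exists_poly_length_le_of_mem_FP (QCircuitFamily.descFn_mem_FP_of_isUniform hU)
  refine ⟨4 * s + 1, fun x => ?_⟩
  have h1 := length_gates_le_length_descFn F x
  have h2 := hs x
  simp only [eval_add, eval_mul, eval_ofNat, eval_one]
  omega

/-- **Enough phase coins**: `k = |descFn x| ≥ 2μ + 4 ≥ h + 2` (every gate code has two symbols and
the description has two more pairing headers). [folklore] -/
theorem hCount_add_two_le (x : List Bool) : hCount (F.circ x.length).gates + 2 ≤ (F.descFn x).length := by
  have h1 := hCount_le_length (F.circ x.length).gates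
  have h2 := two_mul_length_le_length_encList (codes F x)
  have h3 : (codes F x).length = (F.circ x.length).gates.length := List.length_map _
  rw [descFn_eq, length_boolPair, length_boolPair]
  omega

/-! ### The theorem -/

/-- **`PostBQP ⊆ PP`** (Aaronson 2005, Prop. 2). For `L ∈ PostBQP` decided with post-selection by
the uniform oracle-free Clifford+`T` family `F`, take the witness language `postLang F ∈ P`
and the coin polynomial `p` with `p(n) ≥ 2μ(n) + 2k(n) + 1`: on input `x`, of the `2^{p(|x|)}` coin
strings exactly `2^P (4^μ 4^k + X)` are accepted (`P = p(|x|) − 2μ − 2k − 1`), so a strict majority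
accepts iff `X > 0`, which by the sign theorem (`extX_pos`/`extX_neg`, with `k = |descFn x| ≥ h + 2`,
`Pr[post] > 0` and the conditional thresholds `2/3`, `1/3` of `PostBQP`) holds iff `x ∈ L`. For the
tree's Clifford+`T` gate set this replaces the dyadic-rational gate set of the printed proof by the
exact `ℤ[√2]` sign test of `PostBQPPathSums.lean`. [cite: Aaronson2005, §3 Prop. 2] -/
theorem PostBQP_subset_PP : PostBQP ⊆ PP := by
  intro L hL
  obtain ⟨F, hF, hU, hacc⟩ := mem_PostBQP_iff.1 hL
  obtain ⟨p, hp⟩ := exists_postCoinPoly F hU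
  refine ⟨postLang F, postLang_mem_P F hU, p, fun x => ?_⟩
  obtain ⟨P, hP⟩ : ∃ P, p.eval x.length = (F.circ x.length).gates.length + ((F.circ x.length).gates.length +
      ((F.descFn x).length + ((F.descFn x).length + (P + 1)))) :=
    ⟨p.eval x.length - (2 * (F.circ x.length).gates.length + 2 * (F.descFn x).length + 1),
      by have := hp x; omega⟩
  have hbal := two_mul_cnt_postLang_sub F hF x P
  have hk := hCount_add_two_le F x
  rw [half_lt_uniformProb_iff, hP]
  set gs := (F.circ x.length).gates with hgs
  set μ := gs.length with hμ
  set k := (F.descFn x).length with hkd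
  have h2 : (0 : ℤ) < 2 ^ (P + 1) := by positivity
  have key : 2 ^ (μ + (μ + (k + (k + (P + 1))))) < 2 * cnt (μ + (μ + (k + (k + (P + 1)))))
      {y | boolPair x y ∈ postLang F} ↔ 0 < extX evWt gs (w₀ F x) k := by
    constructor
    · intro h
      have h' : (0 : ℤ) < 2 ^ (P + 1) * extX evWt gs (w₀ F x) k := by rw [← hbal]; omega
      exact pos_of_mul_pos_right h' h2.le
    · intro h
      have h' : (0 : ℤ) < 2 ^ (P + 1) * extX evWt gs (w₀ F x) k := mul_pos h2 h
      rw [← hbal] at h'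
      omega
  rw [key]
  -- the sign of `X`
  obtain ⟨hpos, hyes, hno⟩ := hacc x
  have hS : 0 < prS omega gs (w₀ F x) := by rwa [← postselectProbOn_eq_prS F hF 0 x]
  have hcond := condAcceptProbOn_eq F hF x
  constructor
  · intro hx
    have h := hyes hx
    rw [hcond, le_div_iff₀ hS] at h
    exact extX_pos gs (hF x.length) (w₀ F x) hk hS h
  · intro hX
    by_contra hx
    have h := hno hx
    rw [hcond, div_le_iff₀ hS] at h
    have := extX_neg gs (hF x.length) (w₀ F x) hk hS h
    omega

/-- **Reduction of Aaronson's theorem to its algorithmic half.** `PostBQP = PP` (the named fact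
`Cryptography.PostBQP_eq_PP`, Aaronson 2005 Thm. 4) follows from the remaining inclusion
`PP ⊆ PostBQP` (the post-selected counting algorithm of the proof of Thm. 4).
[cite: Aaronson2005, §3 Thm. 4 (proof: "We have already observed that PostBQP ⊆ PP. For the other direction …")] -/
theorem PostBQP_eq_PP_of (h : PP ⊆ PostBQP) : Cryptography.PostBQP_eq_PP :=
  Set.Subset.antisymm PostBQP_subset_PP h

/-- The same reduction for the restated target **quantum-advantage.S16**
(`QuantumComplexity.PostBQP_eq_PP`, definitionally the same statement). [cite: Aaronson2005, §3 Thm. 4] -/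
theorem PostBQP_eq_PP_of' (h : PP ⊆ PostBQP) : QuantumComplexity.PostBQP_eq_PP :=
  Set.Subset.antisymm PostBQP_subset_PP h

end Literature.Computability.QuantumComplexity
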